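import Summits.AtomisticToContinuum.HydrodynamicLimit.Theorems.OneFlightGossipEngineCollisionActivityTailsCfgCollisionSums
import Literature.MathematicalPhysics.KineticTheory.HardSphereEuler
import HarnessLib

/-!
# Collision pair sums with configuration-dependent summands are measurable in the initial datum

Helper file of the lead prover for the registered stub `stub_collisionPairSumMeasurable` (S3) of
the line `KineticSlabSketch` of the crux `JParityClosure.OddContactSymmetry`
(stmt-AtomisticToContinuum-17722).  The line applies Chernoff/Hölder bounds under a Gibbs law to
slab collision sums `Φ.collisionPairSum (Ioc 0 ℓ) gm` along a hard-sphere flow `Φ`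
(`Literature.Analysis.FluidPDE.HardSphereFlow.collisionPairSum`: the sum over the collision times
`t` of the orbit in the window and the ordered contact pairs `(i, j)` at time `t` of
`gm t (Φ_t z) i j`), whose summand — the Metropolis-odd mark — sees the CURRENT CONFIGURATION
`Φ_t z`, not only the collision record; and this mark is continuous only near the contact
configurations of its pair (the minimal-image separation of `𝕋³` is discontinuous far away) and
is known to be measurable in the configuration at each fixed time only.  For the Chernoff bounds
the events `{z | x < |Σ …|}` must be measurable in the initial datum `z`.

The tree's engines prove this measurability by velocity-jump detection over the `2^n` dyadic
cells of the window (only the time-slice measurability `Φ.measurable_flow t` of the flow is used):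
`Literature.Analysis.FluidPDE.EmpiricalCollisionMeasureMeasurable` for summands that are
continuous functions of the collision RECORD, and
`…Theorems.OneFlightGossipEngineCollisionActivityTailsCfgCollisionSums` (`cfgJumpSum`,
`cfgSumApprox`, `cfgJumpSum_cell_eq`, `tendsto_cfgSumApprox`,
`measurable_indicator_collisionPairSum_cfg`) for a family `H i j` of GLOBALLY continuous and
JOINTLY measurable functions of `(time, configuration, pre-collisional configuration)`.  This file
sharpens the latter to the hypotheses the line can supply:

* `tendsto_cfgSumApprox_of_continuousAt` — the convergence
  `cfgSumApprox γ H a b n → Σ_{collisions (t, i, j) in (a, b]} H i j (t, γ t, γ(t⁻))` along a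
  hard-sphere trajectory needs continuity of `H i j` only AT the points
  `(s, γ s, γ(s⁻))` of the collisions `(s, i, j)` of the window (same proof: finitely many
  collisions, each eventually alone in its cell, `cfgJumpSum_cell_eq`; the right end of the cell
  carries the post-collisional velocities and positions converging to those at the collision,
  the left end the exact pre-collisional velocities, `IsHardSphereTrajectory.collidePair_vel_eq`,
  `leftLim_eq_collidePair`);
* `measurable_cfgJumpSum_of_section` — for `H i j (t, z, w) = gm t z i j` the approximants read
  off the orbit are measurable in the datum as soon as each section `z ↦ gm t z i j` is
  (`Φ.measurable_flow`, `measurableSet_eq_fun`);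
* `measurable_indicator_collisionPairSum_Ioc` — hence (`measurable_of_tendsto_metrizable`) the
  collision pair sum `Φ.collisionPairSum (Ioc a b) gm`, extended by `0` off the good set, is
  measurable for every `gm` measurable in `z` at fixed times and continuous at every `(t, z)`
  with `z` a contact configuration of the pair (Hausdorff position space, symmetric contact
  relation);
* `measurable_sum_contactPairs_cfg`, `measurable_indicator_collisionPairSum_Icc` — the closed
  window adds the directly measurable contribution of a collision at time `a`
  (`IsHardSphereTrajectory.collisionPairSum_Icc`, `measurableSet_contactSet`);
* `stub_collisionPairSumMeasurable` — the registered statement on `𝕋³` (`torus_contact_symm`,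
  `Torus.isMeasurable_geometry`; the bounds `0 < ε < 1/2` of the registered signature are not
  needed).

## References

* I. Gallagher, L. Saint-Raymond, B. Texier, *From Newton to Boltzmann: hard spheres and
  short-range potentials*, EMS (2013), §4.1, Prop. 4.1.1, Def. 4.1.2 (hard-sphere trajectories:
  finitely many binary non-grazing collisions, right-continuous velocities).
* M. Pulvirenti, S. Simonella, *On the evolution of the empirical measure for the hard-sphere
  dynamics*, arXiv:1504.03215 (2015), §3 (collision sums along one trajectory).
-/

noncomputable section

open Set MeasureTheory Filter Topology Function
open Literature.Analysis.FluidPDE Literature.MathematicalPhysics.KineticTheory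
open Summit.AtomisticToContinuum.HydrodynamicLimit.Theorems.CollisionActivityTailsCfgCollisionSums

namespace Summit.AtomisticToContinuum.HydrodynamicLimit.Theorems.OddContactSymmetryKineticSlab

/-! ## The dyadic engine under pointwise continuity -/

section Engine

variable {d : Type*} [Fintype d] {X : Type*} {N : ℕ} [TopologicalSpace X] {G : Geometry d X}
  {ε : ℝ} {γ : ℝ → Config N d X}

/-- **Convergence of the configuration-aware dyadic approximation under pointwise continuity.**
Along a hard-sphere trajectory (Hausdorff position space, symmetric contact relation), if for
every collision time `s ∈ (a, b]` and every ordered contact pair `(i, j)` at `s` the function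
`H i j` is continuous AT the point `(s, γ s, γ(s⁻))` (`γ(s⁻) = Function.leftLim γ s`), then
`cfgSumApprox γ H a b n → Σ_{collisions (t, i, j) in (a, b]} H i j (t, γ t, γ(t⁻))` as `n → ∞`
(`tendsto_cfgSumApprox` asks for global continuity of every `H i j`; its proof uses it only at
these finitely many points). [folklore] -/
theorem tendsto_cfgSumApprox_of_continuousAt [T2Space X] (h : IsHardSphereTrajectory G ε N γ)
    (hsymm : ∀ x y : X, ‖G.sepVec x y‖ = ε → ‖G.sepVec y x‖ = ε) {a b : ℝ} (hab : a < b)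
    {H : Fin N → Fin N → ℝ × Config N d X × Config N d X → ℝ}
    (hH : ∀ s ∈ Ioc a b, ∀ p ∈ contactPairs G ε (γ s),
      ContinuousAt (H p.1 p.2) (s, γ s, leftLim γ s)) :
    Tendsto (fun n => cfgSumApprox γ H a b n) atTop
      (𝓝 (collisionPairSum G ε γ (Ioc a b) fun t i j => H i j (t, γ t, leftLim γ t))) := by
  -- adapted from `tendsto_cfgSumApprox` (…CollisionActivityTailsCfgCollisionSums): verbatim,
  -- except for the last line, where only the continuity of `H i j` at the limit point is used
  have hfin : (collisionTimes G ε γ ∩ Ioc a b).Finite :=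
    h.finite_collisionTimes_inter_of_subset_Icc Ioc_subset_Icc_self
  rw [collisionPairSum_eq_finset_sum hfin]
  have hfine := IsHardSphereTrajectory.eventually_fine hfin a b
  -- the approximants, rewritten as sums over the collision times
  have happrox : ∀ᶠ n in atTop, (∑ s ∈ hfin.toFinset, ∑ p ∈ contactPairs G ε (γ s),
      H p.1 p.2 (meshPt a b n (cellIndex a b n s + 1), γ (meshPt a b n (cellIndex a b n s + 1)),
        γ (meshPt a b n (cellIndex a b n s)))) = cfgSumApprox γ H a b n := by
    filter_upwards [hfine] with n hn
    have hmaps : ∀ s ∈ hfin.toFinset, cellIndex a b n s ∈ Finset.range (2 ^ n) := fun s hs =>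
      Finset.mem_range.2 (mem_cell_cellIndex hab n (hfin.mem_toFinset.1 hs).2).1
    symm
    calc cfgSumApprox γ H a b n
        = ∑ k ∈ Finset.range (2 ^ n), ∑ s ∈ hfin.toFinset with cellIndex a b n s = k,
            ∑ p ∈ contactPairs G ε (γ s),
              H p.1 p.2 (meshPt a b n (k + 1), γ (meshPt a b n (k + 1)), γ (meshPt a b n k)) :=
          Finset.sum_congr rfl fun k hk =>
            cfgJumpSum_cell_eq H h hsymm hab hfin hn (Finset.mem_range.1 hk)
      _ = ∑ k ∈ Finset.range (2 ^ n), ∑ s ∈ hfin.toFinset with cellIndex a b n s = k,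
            ∑ p ∈ contactPairs G ε (γ s),
              H p.1 p.2 (meshPt a b n (cellIndex a b n s + 1),
                γ (meshPt a b n (cellIndex a b n s + 1)), γ (meshPt a b n (cellIndex a b n s))) :=
          Finset.sum_congr rfl fun k _ => Finset.sum_congr rfl fun s hs => by
            rw [(Finset.mem_filter.1 hs).2]
      _ = _ := Finset.sum_fiberwise_of_maps_to hmaps _
  refine Tendsto.congr' happrox
    (tendsto_finsetSum _ fun s hs => tendsto_finsetSum _ fun p hp => ?_)
  -- convergence of each term
  obtain ⟨-, hsI⟩ := hfin.mem_toFinset.1 hs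
  have hcell := fun n => (mem_cell_cellIndex hab n hsI).2
  have hmesh : ∀ n, meshPt a b n (cellIndex a b n s + 1) =
      meshPt a b n (cellIndex a b n s) + (b - a) / 2 ^ n := fun n => meshPt_succ a b n _
  have hr' : Tendsto (fun n => meshPt a b n (cellIndex a b n s + 1)) atTop (𝓝 s) := by
    refine tendsto_of_tendsto_of_tendsto_of_le_of_le tendsto_const_nhds
      (by simpa using (tendsto_meshSize a b).const_add s) (fun n => (hcell n).2) fun n => ?_
    have := (hcell n).1
    rw [hmesh n]
    linarith
  have hl' : Tendsto (fun n => meshPt a b n (cellIndex a b n s)) atTop (𝓝 s) := by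
    have h1 : Tendsto (fun n => meshPt a b n (cellIndex a b n s + 1) - (b - a) / 2 ^ n) atTop
        (𝓝 (s - 0)) := hr'.sub (tendsto_meshSize a b)
    rw [sub_zero] at h1
    refine h1.congr fun n => ?_
    rw [hmesh n]
    ring
  -- in a fine mesh the rest of the cell of `s` is collision-free
  have hfree : ∀ᶠ n in atTop, ∀ τ ∈ collisionTimes G ε γ,
      τ ∈ Ioc (meshPt a b n (cellIndex a b n s)) (meshPt a b n (cellIndex a b n s + 1)) →
        τ = s := by
    filter_upwards [hfine] with n hn τ hτ hτcell
    by_contra hne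
    have hidx := (mem_cell_cellIndex hab n hsI).1
    have hT := (IsHardSphereTrajectory.mem_toFinset_of_mem_cell hab hfin hidx hτ hτcell).1
    exact (lt_irrefl _) ((hn τ hT s hs hne).trans (sub_lt_of_mem_cell hτcell (hcell n)))
  have hfreel : ∀ᶠ n in atTop, ∀ τ ∈ Ioo (meshPt a b n (cellIndex a b n s)) s,
      τ ∉ collisionTimes G ε γ := by
    filter_upwards [hfree] with n hn τ hτ hτC
    have := hn τ hτC ⟨hτ.1, hτ.2.le.trans (hcell n).2⟩
    linarith [hτ.2]
  have hfreer : ∀ᶠ n in atTop, ∀ τ ∈ Ioc s (meshPt a b n (cellIndex a b n s + 1)),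
      τ ∉ collisionTimes G ε γ := by
    filter_upwards [hfree] with n hn τ hτ hτC
    have := hn τ hτC ⟨(hcell n).1.trans hτ.1, hτ.2⟩
    linarith [hτ.1]
  obtain ⟨i, j⟩ := p
  obtain ⟨hij, hc⟩ := mem_contactPairs.1 hp
  -- the configuration after the collision: `γ (r n) → γ s`
  have hγr : Tendsto (fun n => γ (meshPt a b n (cellIndex a b n s + 1))) atTop (𝓝 (γ s)) := by
    rw [tendsto_pi_nhds]
    intro k
    rw [Prod.tendsto_iff]
    refine ⟨((h.pos_continuous k).tendsto s).comp hr', tendsto_const_nhds.congr' ?_⟩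
    filter_upwards [hfreer] with n hn
    show (γ s k).2 = (γ (meshPt a b n (cellIndex a b n s + 1)) k).2
    rw [h.free s _ (hcell n).2 hn, freeFlight_apply]
  -- the configuration before the collision: `γ (l n) → γ(s⁻) = collidePair G i j (γ s)`
  have hγl : Tendsto (fun n => γ (meshPt a b n (cellIndex a b n s))) atTop
      (𝓝 (leftLim γ s)) := by
    rw [h.leftLim_eq_collidePair hij hc, tendsto_pi_nhds]
    intro k
    rw [Prod.tendsto_iff]
    refine ⟨?_, tendsto_const_nhds.congr' ?_⟩
    · rw [collidePair_apply_fst]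
      exact ((h.pos_continuous k).tendsto s).comp hl'
    · filter_upwards [hfreel] with n hn
      exact h.collidePair_vel_eq (hcell n).1 hn hij hc k
  exact (hH s hsI (i, j) hp).tendsto.comp (hr'.prodMk_nhds (hγr.prodMk_nhds hγl))

end Engine

/-! ## Along the flow: sectionwise measurable, pointwise continuous summands -/

section Flow

variable {d : Type*} [Fintype d] {X : Type*} {N : ℕ} [MeasureSpace X] [TopologicalSpace X]
  {G : Geometry d X} {ε : ℝ} (Φ : HardSphereFlow G ε N)

/-- The configuration-aware velocity-jump sum over a fixed cell of the summand
`H i j (t, z, w) = gm t z i j`, read off the orbit of `z`, is measurable in `z` as soon as each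
section `z ↦ gm t z i j` is: it only evaluates the flow at the two fixed times `l`, `r`
(`Φ.measurable_flow`; `measurable_cfgJumpSum` asks for joint measurability instead).
[folklore] -/
theorem measurable_cfgJumpSum_of_section {gm : ℝ → Config N d X → Fin N → Fin N → ℝ}
    (hmeas : ∀ (t : ℝ) (i j : Fin N), Measurable fun z => gm t z i j) (l r : ℝ) :
    Measurable fun z => cfgJumpSum (fun t => Φ.flow t z)
      (fun i j (q : ℝ × Config N d X × Config N d X) => gm q.1 q.2.1 i j) l r := by
  unfold cfgJumpSum
  refine Finset.measurable_sum _ fun i _ => Finset.measurable_sum _ fun j _ => ?_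
  have hv : ∀ (t : ℝ) (k : Fin N), Measurable fun z : Config N d X => (Φ.flow t z k).2 :=
    fun t k => ((measurable_pi_apply k).comp (Φ.measurable_flow t)).snd
  refine Measurable.ite ?_ ((hmeas r i j).comp (Φ.measurable_flow r)) measurable_const
  exact (MeasurableSet.const _).inter (((measurableSet_eq_fun (hv r i) (hv l i)).compl).inter
    (measurableSet_eq_fun (hv r j) (hv l j)).compl)

/-- **Measurability of configuration-dependent collision pair sums over `(a, b]`.** Along a
hard-sphere flow (Hausdorff position space, symmetric contact relation), for a summand
`gm t z i j` measurable in `z` at each fixed time and continuous at every `(t, z)` with `z` a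
contact configuration of the pair `i ≠ j`, the collision pair sum
`z ↦ Σ_{collisions (t, i, j) of the orbit of z in (a, b]} gm t (Φ_t z) i j`, extended by `0` off
the good set, is measurable: on the good set it is the pointwise limit of the measurable dyadic
approximations (`tendsto_cfgSumApprox_of_continuousAt`, `measurable_of_tendsto_metrizable`).
[folklore] -/
theorem measurable_indicator_collisionPairSum_Ioc [T2Space X]
    (hsymm : ∀ x y : X, ‖G.sepVec x y‖ = ε → ‖G.sepVec y x‖ = ε)
    {gm : ℝ → Config N d X → Fin N → Fin N → ℝ}
    (hcont : ∀ i j : Fin N, i ≠ j → ∀ (t : ℝ) (z : Config N d X),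
      z ∈ contactSet G N ε i j →
        ContinuousAt (fun p : ℝ × Config N d X => gm p.1 p.2 i j) (t, z))
    (hmeas : ∀ (t : ℝ) (i j : Fin N), Measurable fun z => gm t z i j) (a b : ℝ) :
    Measurable (Φ.good.indicator (Φ.collisionPairSum (Ioc a b) gm)) := by
  by_cases hab : a < b
  · -- the summand as a function of `(time, configuration, pre-collisional configuration)`
    set H : Fin N → Fin N → ℝ × Config N d X × Config N d X → ℝ :=
      fun i j q => gm q.1 q.2.1 i j
    have hproj : Continuous fun q : ℝ × Config N d X × Config N d X => (q.1, q.2.1) := by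
      fun_prop
    refine measurable_of_tendsto_metrizable (f := fun n => Φ.good.indicator fun z =>
      cfgSumApprox (fun t => Φ.flow t z) H a b n)
      (fun n => (Finset.measurable_sum _ fun k _ =>
        measurable_cfgJumpSum_of_section Φ hmeas _ _).indicator Φ.measurableSet_good) ?_
    rw [tendsto_pi_nhds]
    intro z
    by_cases hz : z ∈ Φ.good
    · simp only [indicator_of_mem hz]
      refine tendsto_cfgSumApprox_of_continuousAt (Φ.isTrajectory z hz) hsymm hab
        fun s _ p hp => ?_
      obtain ⟨hne, hc⟩ := mem_contactPairs.1 hp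
      exact (hcont p.1 p.2 hne s _ hc).comp_of_eq hproj.continuousAt rfl
    · simp only [indicator_of_notMem hz]
      exact tendsto_const_nhds
  · have h0 : Φ.collisionPairSum (Ioc a b) gm = fun _ => 0 := by
      funext z
      rw [HardSphereFlow.collisionPairSum, Ioc_eq_empty hab, collisionPairSum_empty]
    rw [h0]
    exact measurable_const.indicator Φ.measurableSet_good

/-- The contribution of a collision at the fixed time `a`,
`Σ_{(i,j) ∈ contactPairs (Φ_a z)} gm a (Φ_a z) i j`, is measurable in the datum (measurable
geometry: contact sets are measurable). [folklore] -/
theorem measurable_sum_contactPairs_cfg {E : Type*} [AddCommMonoid E] [MeasurableSpace E]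
    [MeasurableAdd₂ E] (hGm : G.IsMeasurable) {gm : ℝ → Config N d X → Fin N → Fin N → E}
    (hmeas : ∀ (t : ℝ) (i j : Fin N), Measurable fun z => gm t z i j) (a : ℝ) :
    Measurable fun z => ∑ p ∈ contactPairs G ε (Φ.flow a z), gm a (Φ.flow a z) p.1 p.2 := by
  classical
  have hrw : ∀ z : Config N d X,
      (∑ p ∈ contactPairs G ε (Φ.flow a z), gm a (Φ.flow a z) p.1 p.2) =
        ∑ p : Fin N × Fin N, if p.1 ≠ p.2 ∧ Φ.flow a z ∈ contactSet G N ε p.1 p.2 then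
          gm a (Φ.flow a z) p.1 p.2 else 0 := by
    intro z
    rw [contactPairs, Finset.sum_filter]
  simp_rw [hrw]
  refine Finset.measurable_sum _ fun p _ => Measurable.ite ?_ ?_ measurable_const
  · exact (MeasurableSet.const _).inter
      ((measurableSet_contactSet G hGm.measurable_sepVec N ε p.1 p.2).preimage
        (Φ.measurable_flow a))
  · exact (hmeas a p.1 p.2).comp (Φ.measurable_flow a)

/-- **Measurability of configuration-dependent collision pair sums over `[a, b]`**: as
`measurable_indicator_collisionPairSum_Ioc`, plus the measurable contribution of a collision at
time `a` (`IsHardSphereTrajectory.collisionPairSum_Icc`, `measurable_sum_contactPairs_cfg`).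
[folklore] -/
theorem measurable_indicator_collisionPairSum_Icc [T2Space X]
    (hsymm : ∀ x y : X, ‖G.sepVec x y‖ = ε → ‖G.sepVec y x‖ = ε) (hGm : G.IsMeasurable)
    {gm : ℝ → Config N d X → Fin N → Fin N → ℝ}
    (hcont : ∀ i j : Fin N, i ≠ j → ∀ (t : ℝ) (z : Config N d X),
      z ∈ contactSet G N ε i j →
        ContinuousAt (fun p : ℝ × Config N d X => gm p.1 p.2 i j) (t, z))
    (hmeas : ∀ (t : ℝ) (i j : Fin N), Measurable fun z => gm t z i j) (a b : ℝ) :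
    Measurable (Φ.good.indicator (Φ.collisionPairSum (Icc a b) gm)) := by
  by_cases hab : a ≤ b
  · have hsplit : Φ.good.indicator (Φ.collisionPairSum (Icc a b) gm) =
        (Φ.good.indicator fun z => ∑ p ∈ contactPairs G ε (Φ.flow a z),
          gm a (Φ.flow a z) p.1 p.2) +
        Φ.good.indicator (Φ.collisionPairSum (Ioc a b) gm) := by
      rw [← indicator_add']
      refine indicator_congr fun z hz => ?_
      exact (Φ.isTrajectory z hz).collisionPairSum_Icc hab _
    rw [hsplit]
    exact ((measurable_sum_contactPairs_cfg Φ hGm hmeas a).indicator Φ.measurableSet_good).add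
      (measurable_indicator_collisionPairSum_Ioc Φ hsymm hcont hmeas a b)
  · have h0 : Φ.collisionPairSum (Icc a b) gm = fun _ => 0 := by
      funext z
      rw [HardSphereFlow.collisionPairSum, Icc_eq_empty hab, collisionPairSum_empty]
    rw [h0]
    exact measurable_const.indicator Φ.measurableSet_good

end Flow

/-! ## The registered stub -/

/-- **S3 `stub_collisionPairSumMeasurable` — collision pair sums with configuration-dependent
summands are measurable in the initial datum.**  For spheres of diameter `ε` on `𝕋³` and a
summand `gm t z i j` that is continuous at every `(t, z)` with `z` a contact configuration of the
pair `i ≠ j` and measurable in `z` at each fixed time, the collision pair sums over `(a, b]` and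
`[a, b]` along the flow, extended by `0` off the good set, are measurable (velocity-jump
approximants on dyadic meshes; on the torus contact is symmetric and contact sets are measurable
at every diameter, so the registered bounds `0 < ε < 1/2` are not used). [folklore] -/
theorem stub_collisionPairSumMeasurable {ε : ℝ} (_hε : 0 < ε) (_hε2 : ε < 2⁻¹) {n : ℕ}
    (Φ : HardSphereFlow (Torus.geometry (Fin 3)) ε n)
    (gm : ℝ → Config n (Fin 3) T3 → Fin n → Fin n → ℝ)
    (hcont : ∀ i j : Fin n, i ≠ j → ∀ (t : ℝ) (z : Config n (Fin 3) T3),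
      z ∈ contactSet (Torus.geometry (Fin 3)) n ε i j →
      ContinuousAt (fun p : ℝ × Config n (Fin 3) T3 => gm p.1 p.2 i j) (t, z))
    (hmeas : ∀ (t : ℝ) (i j : Fin n), Measurable fun z => gm t z i j) (a b : ℝ) :
    Measurable ((Φ.good).indicator (Φ.collisionPairSum (Set.Ioc a b) gm)) ∧
      Measurable ((Φ.good).indicator (Φ.collisionPairSum (Set.Icc a b) gm)) :=
  ⟨measurable_indicator_collisionPairSum_Ioc Φ (torus_contact_symm ε) hcont hmeas a b,
    measurable_indicator_collisionPairSum_Icc Φ (torus_contact_symm ε)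
      Torus.isMeasurable_geometry hcont hmeas a b⟩

end Summit.AtomisticToContinuum.HydrodynamicLimit.Theorems.OddContactSymmetryKineticSlab

end
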